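import Mathlib.Algebra.MvPolynomial.Eval
import Mathlib.Algebra.Order.BigOperators.Group.Finset
import Mathlib.Algebra.Order.AbsoluteValue.Basic
import Mathlib.Data.Real.Basic
import Mathlib.Data.Finset.Max
import Mathlib.Tactic.Positivity
import Mathlib.Tactic.Linarith
import HarnessLib

/-!
# Borinsky's tropical approximation `p^tr` of a multivariate polynomial and the elementary half of its approximation property (AIHPD 2023 = arXiv:2008.12310, §3: Definition 6, Theorem 8a, the positive-coefficient case of Theorem 8b; §2: Definitions 1–2)

independent recomputation; certified where stated, statistical where stated; no new-physics claim.

CITATION HEADER (venture `QEDPrecision`, cell `pub-qed`; literature seat gen 22; VALUE-FREE: definitions and inequalities about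
abstract polynomials only — no Feynman integral, no Monte-Carlo value, nothing per Set V family). Serves the IR/SE lane's A1 row
(`irse/SEATS.md` v1.1 A1: sector decomposition / reparametrisation as a named candidate; `irse/IDEAS-subtraction.md` card C3,
`irse/IDEAS-sampler.md` A1 ROW M2/M3, `irse/B-SAMPLER-DESIGN.md` §6 E9.fan) together with the source sheet
`irse/lit/SECTOR-DECOMP-EXTRACT-lit.md` §3: the 'bounded weights' mechanism those cards cite is Borinsky's Theorem 8 / Corollary 9 fed
into Proposition 20; this file types the definition of `p^tr` and PROVES the half of Theorem 8 whose proof the paper prints in one line,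
plus the printed 'trivial special case' of the other half. Source: [Borinsky2020] M. Borinsky, "Tropical Monte Carlo quadrature for
Feynman integrals", Ann. Inst. Henri Poincaré D 10 (2023) 635–685, doi:10.4171/aihpd/158 = arXiv:2008.12310v2 (LaTeX e-print held by the cell, HOME
`data/lit/sources/.cache/2008.12310/tropical.tex`; theorem numbers = the e-print's single shared counter, verified against the
cross-references «[Theorem 8]» / «[Remark 35]» printed in Borinsky–Munch–Tellander, CPC 292 (2023) 108874, see the source sheet §0).

VERBATIM [Borinsky2020]. §2 (l.295–297): "p(x) = Σ_{ℓ∈supp(p)} c_ℓ Π_{k=1}^n x_k^{ℓ_k} = Σ_{ℓ∈supp(p)} c_ℓ x^ℓ, where supp(p), the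
support of p, is the set of all multi-indices … ℓ ∈ ℤⁿ such that c_ℓ ≠ 0." Definition 1 (l.302–306): "For each face F of NP_p associated
to a polynomial p, we define the truncated polynomial p_F by p_F(x) = Σ_{ℓ ∈ F ∩ supp(p)} c_ℓ x^ℓ." — with (l.291) "Equivalently, a face of
a polytope is a subset of 𝒫 which maximizes a given linear functional y ∈ ℝⁿ, F = {v ∈ 𝒫 : ⟨y,v⟩ = max_{w∈𝒫} ⟨y,w⟩}". Definition 2
(l.309–311): "A polynomial p ∈ ℂ[x₁,…,x_n] is completely non-vanishing on a domain X if for each face F ⊂ NP_p, the truncated polynomial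
p_F does not vanish on X." Definition 6 (l.399–403): "For a polynomial p ∈ ℂ[x₁,…,x_n] define p^tr(x) = max_{ℓ∈supp(p)} x^ℓ."
Theorem 8a (l.446–453): "For every polynomial p ∈ ℂ[x₁,…,x_n] there is a constant C > 0 such that |p(x)| ≤ C p^tr(x) for all
x ∈ ℝⁿ_{>0}." with the printed proof "C = Σ_{ℓ∈supp(p)} |c_ℓ|." Theorem 8b (l.455–459): "If p ∈ ℂ[x₁,…,x_n] is completely non-vanishing
on ℝⁿ_{>0}, then there is a constant C > 0 such that C p^tr(x) ≤ |p(x)| for all x ∈ ℝⁿ_{>0}." and (l.477–478): "Theorem 8b is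
substantially harder to prove than Theorem 8a. … Only a special case is also trivial: If the polynomial p has only positive coefficients
(which implies that p is completely non-vanishing on ℝⁿ_{>0}), there is a simple lower bound for |p(x)|: take for instance
C = min_{ℓ∈supp(p)} c_ℓ." Panzer's form of the same pair of bounds for the Kirchhoff polynomial (all coefficients 1), [Panzer2022] E. Panzer,
AIHPD 10 (2023) 31 = arXiv:1908.09820v3, §2 (HOME `data/lit/sources/.cache/1908.09820/hepp.tex` l.343): "The inequality Ψ^tr_G ≤ Ψ_G ≤ Ψ^tr_G · |ST(G)| … shows that both Mellin integrals
… have the same domain of convergence." — typed here for an arbitrary polynomial all of whose (non-zero) coefficients equal 1.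

TYPING. Real coefficients (the cell's integrands are real; the paper allows ℂ — TODO(general form): `MvPolynomial σ ℂ` with `‖·‖`, same
proofs). A point is `x : σ → ℝ`; the statements carry the hypothesis `∀ i, 0 ≤ x i` resp. `0 < x i` exactly where the printed proof uses
it (monomials non-negative resp. positive); the paper states everything on ℝⁿ_{>0}. `monom d x = Π_{i∈supp d} x_i^{d_i}` is the monomial
x^ℓ written as in `MvPolynomial.eval_eq`. `trop p x` = Definition 6 (`Finset.sup'` over the support; the zero polynomial, which has no
tropical approximation in print, gets the junk value 0). Faces are typed through their defining functional (l.291): `trunc p y` keeps the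
monomials of `p` on which ℓ ↦ Σ_i y_i ℓ_i attains its maximum over supp(p); `CompletelyNonVanishing p X` = Definition 2 with F ranging over
these exposed faces (for a polytope every face is exposed, which is the equivalence the paper states at l.291).
PROVED: `abs_eval_le_sumAbsCoeff_mul_trop` (= Theorem 8a with the printed constant), `minCoeff_mul_trop_le_eval` (= the printed special
case of 8b, constant min c_ℓ), `trop_le_eval_of_coeff_eq_one` / `eval_le_card_mul_trop_of_coeff_eq_one` (Panzer's Ψ^tr ≤ Ψ ≤ |ST|·Ψ^tr
shape), `completelyNonVanishing_of_coeff_pos` (= the printed parenthesis "(which implies that p is completely non-vanishing on ℝⁿ_{>0})").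
NOT typed: Theorem 8b in general (the cone-by-cone argument of §3.3, Lemmas 10–12 / Proposition 13), Theorem 3, §4–§7.
-/

namespace Literature.MathematicalPhysics.QuantumFieldTheory.Borinsky2020

open MvPolynomial Finset

noncomputable section

variable {σ : Type*}

/-! ## The monomial x^ℓ and the tropical approximation p^tr (Definition 6) -/

/-- The monomial `x^ℓ = Π_k x_k^{ℓ_k}` of a multi-index `ℓ` (written over `ℓ.support`, as in `MvPolynomial.eval_eq`).
[cite: Borinsky2020, §2 (tropical.tex l.295–297)] -/
def monom (d : σ →₀ ℕ) (x : σ → ℝ) : ℝ := ∏ i ∈ d.support, x i ^ d i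

/-- `x^ℓ ≥ 0` on the closed positive orthant. [folklore] -/
private theorem monom_nonneg {x : σ → ℝ} (hx : ∀ i, 0 ≤ x i) (d : σ →₀ ℕ) : 0 ≤ monom d x :=
  Finset.prod_nonneg fun i _ => pow_nonneg (hx i) _

/-- `x^ℓ > 0` on the open positive orthant. [folklore] -/
private theorem monom_pos {x : σ → ℝ} (hx : ∀ i, 0 < x i) (d : σ →₀ ℕ) : 0 < monom d x :=
  Finset.prod_pos fun i _ => pow_pos (hx i) _

/-- `p(x) = Σ_{ℓ∈supp(p)} c_ℓ x^ℓ` — `MvPolynomial.eval` written with `monom`. [cite: Borinsky2020, §2 (l.295–297)] -/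
theorem eval_eq_sum_coeff_mul_monom (x : σ → ℝ) (p : MvPolynomial σ ℝ) :
    eval x p = ∑ d ∈ p.support, p.coeff d * monom d x :=
  MvPolynomial.eval_eq x p

/-- Definition 6: `p^tr(x) = max_{ℓ∈supp(p)} x^ℓ` (for `p = 0`, whose support is empty, the junk value `0`).
[cite: Borinsky2020, Definition 6 (tropical.tex l.399–403)] -/
def trop (p : MvPolynomial σ ℝ) (x : σ → ℝ) : ℝ :=
  if h : p.support.Nonempty then p.support.sup' h (fun d => monom d x) else 0

/-- Unfolding of `trop` for `p ≠ 0`. [folklore] -/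
private theorem trop_def_of_ne_zero {p : MvPolynomial σ ℝ} (hp : p ≠ 0) (x : σ → ℝ) :
    trop p x = p.support.sup' (support_nonempty.mpr hp) (fun d => monom d x) := by
  simp [trop, support_nonempty.mpr hp]

/-- Junk value at the zero polynomial. [folklore] -/
@[simp] private theorem trop_zero (x : σ → ℝ) : trop (0 : MvPolynomial σ ℝ) x = 0 := by
  simp [trop]

/-- Every monomial of the support is bounded by `p^tr` (Definition 6: `p^tr` is their maximum).
[cite: Borinsky2020, Definition 6 (tropical.tex l.399–403)] -/
theorem monom_le_trop {p : MvPolynomial σ ℝ} {d : σ →₀ ℕ} (hd : d ∈ p.support) (x : σ → ℝ) :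
    monom d x ≤ trop p x := by
  have h : p.support.Nonempty := ⟨d, hd⟩
  simp only [trop, h, ↓reduceDIte]
  exact Finset.le_sup' (fun d => monom d x) hd

/-- `p^tr(x)` is attained: it is one of the monomials of the support (for `p ≠ 0`; Definition 6 is a maximum over the finite set
`supp(p)`). [cite: Borinsky2020, Definition 6 (tropical.tex l.399–403)] -/
theorem exists_monom_eq_trop {p : MvPolynomial σ ℝ} (hp : p ≠ 0) (x : σ → ℝ) :
    ∃ d ∈ p.support, monom d x = trop p x := by
  obtain ⟨d, hd, h⟩ := Finset.exists_mem_eq_sup' (support_nonempty.mpr hp) (fun d => monom d x)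
  exact ⟨d, hd, by rw [trop_def_of_ne_zero hp, h]⟩

/-- `p^tr ≥ 0` on the closed positive orthant. [folklore] -/
private theorem trop_nonneg {x : σ → ℝ} (hx : ∀ i, 0 ≤ x i) (p : MvPolynomial σ ℝ) : 0 ≤ trop p x := by
  by_cases hp : p = 0
  · simp [hp]
  · obtain ⟨d, hd, h⟩ := exists_monom_eq_trop hp x
    rw [← h]; exact monom_nonneg hx d

/-- `p^tr(x) > 0` for `p ≠ 0` and `x ∈ ℝⁿ_{>0}` ("the integrand in eq. (integral_trop) is obviously positive for all x ∈ ℙ^{n−1}_{>0}").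
[cite: Borinsky2020, §5 (tropical.tex l.890)] -/
theorem trop_pos {x : σ → ℝ} (hx : ∀ i, 0 < x i) {p : MvPolynomial σ ℝ} (hp : p ≠ 0) : 0 < trop p x := by
  obtain ⟨d, hd, h⟩ := exists_monom_eq_trop hp x
  rw [← h]; exact monom_pos hx d

/-! ## Theorem 8a: |p(x)| ≤ (Σ_ℓ |c_ℓ|) · p^tr(x) -/

/-- The printed constant of Theorem 8a: `C = Σ_{ℓ∈supp(p)} |c_ℓ|`. [cite: Borinsky2020, proof of Theorem 8a (l.451–453)] -/
def sumAbsCoeff (p : MvPolynomial σ ℝ) : ℝ := ∑ d ∈ p.support, |p.coeff d|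

/-- **Theorem 8a** with its printed constant: `|p(x)| ≤ (Σ_{ℓ∈supp(p)} |c_ℓ|) · p^tr(x)` for all `x` with non-negative coordinates
(the paper: `x ∈ ℝⁿ_{>0}`). [cite: Borinsky2020, Theorem 8a (tropical.tex l.446–453)] -/
theorem abs_eval_le_sumAbsCoeff_mul_trop (p : MvPolynomial σ ℝ) {x : σ → ℝ} (hx : ∀ i, 0 ≤ x i) :
    |eval x p| ≤ sumAbsCoeff p * trop p x := by
  rw [eval_eq_sum_coeff_mul_monom, sumAbsCoeff, Finset.sum_mul]
  refine (Finset.abs_sum_le_sum_abs _ _).trans (Finset.sum_le_sum fun d hd => ?_)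
  rw [abs_mul, abs_of_nonneg (monom_nonneg hx d)]
  exact mul_le_mul_of_nonneg_left (monom_le_trop hd x) (abs_nonneg _)

/-! ## The printed special case of Theorem 8b: positive coefficients -/

/-- The printed constant of the special case: `C = min_{ℓ∈supp(p)} c_ℓ` (junk value `0` for `p = 0`).
[cite: Borinsky2020, §3.2 after Theorem 8 (l.477)] -/
def minCoeff (p : MvPolynomial σ ℝ) : ℝ :=
  if h : p.support.Nonempty then p.support.inf' h (fun d => p.coeff d) else 0

/-- `min c_ℓ ≤ c_ℓ`. [folklore] -/
private theorem minCoeff_le_coeff {p : MvPolynomial σ ℝ} {d : σ →₀ ℕ} (hd : d ∈ p.support) : minCoeff p ≤ p.coeff d := by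
  have h : p.support.Nonempty := ⟨d, hd⟩
  simp only [minCoeff, h, ↓reduceDIte]
  exact Finset.inf'_le (fun d => p.coeff d) hd

/-- `min c_ℓ > 0` when all coefficients on the support are positive. [folklore] -/
private theorem minCoeff_pos {p : MvPolynomial σ ℝ} (hp : p ≠ 0) (hpos : ∀ d ∈ p.support, 0 < p.coeff d) : 0 < minCoeff p := by
  have h : p.support.Nonempty := support_nonempty.mpr hp
  simp only [minCoeff, h, ↓reduceDIte]
  obtain ⟨d, hd, hmin⟩ := Finset.exists_mem_eq_inf' h (fun d => p.coeff d)
  rw [hmin]; exact hpos d hd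

/-- "If the polynomial p has only positive coefficients …, there is a simple lower bound for |p(x)|: take for instance
C = min_{ℓ∈supp(p)} c_ℓ": `(min_ℓ c_ℓ) · p^tr(x) ≤ p(x)` on the closed positive orthant. (Only `0 ≤ c_ℓ` on the support is used.)
[cite: Borinsky2020, §3.2 after Theorem 8 (tropical.tex l.477–478)] -/
theorem minCoeff_mul_trop_le_eval (p : MvPolynomial σ ℝ) (hpos : ∀ d ∈ p.support, 0 ≤ p.coeff d)
    {x : σ → ℝ} (hx : ∀ i, 0 ≤ x i) : minCoeff p * trop p x ≤ eval x p := by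
  by_cases hp : p = 0
  · simp [hp, minCoeff]
  obtain ⟨d₀, hd₀, hmax⟩ := exists_monom_eq_trop hp x
  rw [eval_eq_sum_coeff_mul_monom, ← hmax]
  calc minCoeff p * monom d₀ x ≤ p.coeff d₀ * monom d₀ x :=
        mul_le_mul_of_nonneg_right (minCoeff_le_coeff hd₀) (monom_nonneg hx d₀)
    _ ≤ ∑ d ∈ p.support, p.coeff d * monom d x :=
        Finset.single_le_sum (fun d hd => mul_nonneg (hpos d hd) (monom_nonneg hx d)) hd₀

/-- The two-sided bound for a polynomial with positive coefficients, in the shape BMT 2023 Theorem 3.1 quotes it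
(`C₁ ≤ |p|/p^tr ≤ C₂`): `(min c_ℓ)·p^tr ≤ p ≤ (Σ c_ℓ)·p^tr`. [cite: Borinsky2020, Theorem 8 (l.443–478)] -/
theorem trop_two_sided_of_coeff_nonneg (p : MvPolynomial σ ℝ) (hpos : ∀ d ∈ p.support, 0 ≤ p.coeff d)
    {x : σ → ℝ} (hx : ∀ i, 0 ≤ x i) :
    minCoeff p * trop p x ≤ eval x p ∧ eval x p ≤ sumAbsCoeff p * trop p x :=
  ⟨minCoeff_mul_trop_le_eval p hpos hx, (le_abs_self _).trans (abs_eval_le_sumAbsCoeff_mul_trop p hx)⟩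

/-! ## Panzer's shape: all coefficients equal to 1 (Ψ^tr ≤ Ψ ≤ |ST(G)|·Ψ^tr) -/

/-- Lower half of Panzer's inequality for a 0/1-coefficient polynomial: `p^tr(x) ≤ p(x)`.
[cite: Panzer2022, §2 (hepp.tex l.343)] [cite: Borinsky2020, §3.2 (l.477)] -/
theorem trop_le_eval_of_coeff_eq_one (p : MvPolynomial σ ℝ) (h1 : ∀ d ∈ p.support, p.coeff d = 1)
    {x : σ → ℝ} (hx : ∀ i, 0 ≤ x i) : trop p x ≤ eval x p := by
  by_cases hp : p = 0
  · simp [hp]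
  have hmin : minCoeff p = 1 := by
    have h : p.support.Nonempty := support_nonempty.mpr hp
    simp only [minCoeff, h, ↓reduceDIte]
    obtain ⟨d, hd, hmin⟩ := Finset.exists_mem_eq_inf' h (fun d => p.coeff d)
    rw [hmin, h1 d hd]
  have := minCoeff_mul_trop_le_eval p (fun d hd => by rw [h1 d hd]; exact zero_le_one) hx
  simpa [hmin] using this

/-- Upper half of Panzer's inequality for a 0/1-coefficient polynomial: `p(x) ≤ |supp(p)| · p^tr(x)` (for the Kirchhoff polynomial
`|supp| = |ST(G)|`, the number of spanning trees). [cite: Panzer2022, §2 (hepp.tex l.343)] [cite: Borinsky2020, Theorem 8a] -/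
theorem eval_le_card_mul_trop_of_coeff_eq_one (p : MvPolynomial σ ℝ) (h1 : ∀ d ∈ p.support, p.coeff d = 1)
    {x : σ → ℝ} (hx : ∀ i, 0 ≤ x i) : eval x p ≤ (p.support.card : ℝ) * trop p x := by
  have hC : sumAbsCoeff p = p.support.card := by
    rw [sumAbsCoeff, Finset.card_eq_sum_ones, Nat.cast_sum]
    exact Finset.sum_congr rfl fun d hd => by simp [h1 d hd]
  have := abs_eval_le_sumAbsCoeff_mul_trop p hx
  rw [hC] at this
  exact (le_abs_self _).trans this

/-! ## Definitions 1–2: truncations to faces and 'completely non-vanishing' -/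

/-- The linear functional `ℓ ↦ ⟨y, ℓ⟩ = Σ_k y_k ℓ_k` on multi-indices that cuts out a face ("we will identify the space of linear forms
on ℝⁿ with ℝⁿ via the usual scalar product ⟨v, w⟩ = Σ_{k=1}^n v_k w_k … a face of a polytope is a subset of 𝒫 which maximizes a given
linear functional y"). [cite: Borinsky2020, §2 (tropical.tex l.291)] -/
def pairing (y : σ → ℝ) (d : σ →₀ ℕ) : ℝ := ∑ i ∈ d.support, y i * (d i : ℝ)

/-- The maximum of `⟨y, ·⟩` over `supp(p)` (junk `0` for `p = 0`): the value cut out by the face `F_y` of `NP_p`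
("a face of a polytope is a subset of 𝒫 which maximizes a given linear functional y"). [cite: Borinsky2020, §2 (l.291)] -/
def faceValue (p : MvPolynomial σ ℝ) (y : σ → ℝ) : ℝ :=
  if h : p.support.Nonempty then p.support.sup' h (pairing y) else 0

open Classical in
/-- Definition 1 for the face exposed by `y`: the truncated polynomial `p_F(x) = Σ_{ℓ ∈ F ∩ supp(p)} c_ℓ x^ℓ`, `F = F_y` the set of
maximisers of `⟨y, ·⟩` on the Newton polytope (equivalently on `supp(p)`, since a linear functional on a polytope attains its maximum at
vertices, which lie in `supp(p)`). [cite: Borinsky2020, Definition 1 (tropical.tex l.302–306) with l.291] -/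
def trunc (p : MvPolynomial σ ℝ) (y : σ → ℝ) : MvPolynomial σ ℝ :=
  ∑ d ∈ p.support.filter (fun d => pairing y d = faceValue p y), monomial d (p.coeff d)

/-- Definition 2: `p` is completely non-vanishing on `X` iff no truncation `p_F` (F a face of `NP_p`; here: F = F_y for every functional
`y`, `y = 0` giving `F = NP_p`, i.e. `p` itself) vanishes at a point of `X`. [cite: Borinsky2020, Definition 2 (tropical.tex l.309–311)] -/
def CompletelyNonVanishing (p : MvPolynomial σ ℝ) (X : Set (σ → ℝ)) : Prop :=
  ∀ y : σ → ℝ, ∀ x ∈ X, eval x (trunc p y) ≠ 0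

open Classical in
/-- `p_F(x) = Σ_{ℓ ∈ F ∩ supp(p)} c_ℓ x^ℓ` for the face `F = F_y`. [cite: Borinsky2020, Definition 1 (tropical.tex l.302–306)] -/
theorem eval_trunc (p : MvPolynomial σ ℝ) (y : σ → ℝ) (x : σ → ℝ) :
    eval x (trunc p y) = ∑ d ∈ p.support.filter (fun d => pairing y d = faceValue p y), p.coeff d * monom d x := by
  simp only [trunc, map_sum, eval_monomial, monom, Finsupp.prod]

open Classical in
/-- "(which implies that p is completely non-vanishing on ℝⁿ_{>0})": a polynomial with only positive coefficients is completely
non-vanishing on the open positive orthant — every truncation is a non-empty sum of positive terms there.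
[cite: Borinsky2020, §3.2 (tropical.tex l.477)] -/
theorem completelyNonVanishing_of_coeff_pos (p : MvPolynomial σ ℝ) (hp : p ≠ 0)
    (hpos : ∀ d ∈ p.support, 0 < p.coeff d) : CompletelyNonVanishing p {x | ∀ i, 0 < x i} := by
  intro y x hx
  rw [eval_trunc]
  have hne : (p.support.filter (fun d => pairing y d = faceValue p y)).Nonempty := by
    obtain ⟨d, hd, h⟩ := Finset.exists_mem_eq_sup' (support_nonempty.mpr hp) (pairing y)
    refine ⟨d, Finset.mem_filter.mpr ⟨hd, ?_⟩⟩
    simp only [faceValue, support_nonempty.mpr hp, ↓reduceDIte]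
    exact h.symm
  exact (Finset.sum_pos (fun d hd => mul_pos (hpos d (Finset.mem_filter.mp hd).1) (monom_pos hx d)) hne).ne'

end

end Literature.MathematicalPhysics.QuantumFieldTheory.Borinsky2020
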